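import Literature.AlgebraicGeometry.Motives.FlatOverSmoothCurve
import Literature.AlgebraicGeometry.Motives.CartierDivisorClassPullback
import Literature.NumberTheory.DiophantineGeometry.FunctionFieldDivisors
import Mathlib.AlgebraicGeometry.ValuativeCriterion
import HarnessLib

/-!
# Closed points of a complete nonsingular curve and the places of its function field
# (Hartshorne II.6, Lemma 6.5 / Cor. 6.6; Stichtenoth I.1)

For a curve `C` over a field `K` — an integral `K`-scheme `C : SchemeOver K` smooth of relative
dimension one — with function field `K(C)` (Mathlib `Scheme.functionField`, a `K`-algebra through
`RatFn.algebraStalk` of `Motives/CartierDivisor`), this file identifies the non-generic (= closed)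
points of `C` with the **places of `K(C)/K`** in the sense of the tree's function-field library
(`Literature.NumberTheory.DiophantineGeometry.AlgFunctionField.PlaceOver`: discrete valuation rings
`K ⊆ 𝒪 ⊊ K(C)`), as in Hartshorne II.6 ("`P ↦ 𝒪_P` … the points of `C` are in one-to-one
correspondence with the discrete valuation rings of `K/k`", Lemma 6.5, Cor. 6.6 and Cor. 6.7):

* `valuationSubringOfPoint x` — `𝒪_{C,x} ⊆ K(C)` as a valuation subring when `𝒪_{C,x}` is a
  valuation ring; `placeOfPoint x` — the place when `𝒪_{C,x}` is a discrete valuation ring;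
  `isDiscreteValuationRing_stalk` — which is the case at every non-generic point of a smooth curve
  (the tree's `valuationRing_stalk_of_smoothCurve`, noetherianity, and
  `maximalIdeal_ne_bot_of_ne_genericPoint`); `place C x hx : PlaceOver K K(C)` with
  `mem_place_iff : f ∈ 𝒪_{place x} ↔ IsRegularAt x f`.
* `place_injective` — for `C` separated over `K`: the valuative square `placeSq v` of a place
  (`Spec K(C) → C` over `Spec 𝒪_v → Spec K`) has the lift `liftOfPoint` through every centre of
  `v`, sending the closed point to the centre (`liftOfPoint_closedPoint`), and lifts are unique
  (Mathlib `IsSeparated.valuativeCriterion`).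
* `exists_place_eq` — for `C` proper over `K`: every place is the place of a point (existence of
  lifts, Mathlib `UniversallyClosed.eq_valuativeCriterion`; the centre's local ring maps into
  `𝒪_v` compatibly with `K(C)` because `Spec 𝒪_{C,x} → C` is a monomorphism,
  `ringHom_ext_of_fromSpecStalk`; then `𝒪_{C,x} ⊆ 𝒪_v` are valuation rings of `K(C)` with
  `𝒪_{C,x}` discrete, hence equal, Mathlib `ValuationSubring.eq_of_le_of_ne_top`).
* `pointEquivPlace : {x // x ≠ genericPoint} ≃ PlaceOver K K(C)`, `pointOfPlace`,
  `mem_iff_isRegularAt_pointOfPlace`.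

This is the first half of the dictionary between the curve side (`Motives/CartierDivisor*`,
`CartierDivisorCurveDegree`) and the function-field side (`FunctionFieldDivisors`,
`FunctionFieldGenus`, where the Riemann–Roch theorem is proved, `FunctionFieldAdelesProofs`) used
for Riemann–Roch on curves (Milne, *Jacobian Varieties*, §§4–5). Everything is proved; no named
facts (D-0026).

Mathlib searched (pin): `Scheme.fromSpecStalk`, `Scheme.range_fromSpecStalk`,
`Scheme.SpecMap_stalkSpecializes_fromSpecStalk`, `Scheme.stalkClosedPointTo`,
`Scheme.Spec_stalkClosedPointTo_fromSpecStalk`, `IsPreimmersion (X.fromSpecStalk x)` (hence `Mono`),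
`ValuativeCommSq`, `IsSeparated.valuativeCriterion`, `UniversallyClosed.eq_valuativeCriterion`,
`ValuationRing.isInteger_or_isInteger`, `tfae_of_isNoetherianRing_of_isLocalRing_of_isDomain`,
`ValuationSubring.eq_of_le_of_ne_top`, `IsLocalRing.comap_closedPoint` (all used); Mathlib has no
places of function fields and no such dictionary.

## References

* R. Hartshorne, *Algebraic Geometry*, GTM 52 (1977): I Thm. 6.2A, II.4 Thm. 4.3 and Thm. 4.7
  (valuative criteria), II.6 Lemma 6.5, Cor. 6.6, Cor. 6.7. [Hartshorne1977]
* H. Stichtenoth, *Algebraic Function Fields and Codes*, 2nd ed., GTM 254 (2009), I.1 (places).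
  [Stichtenoth2009]
-/

noncomputable section

open CategoryTheory AlgebraicGeometry IsLocalRing

universe u

namespace Literature.AlgebraicGeometry.Motives

namespace CurvePlaces

open RatFn Literature.NumberTheory.DiophantineGeometry
  Literature.NumberTheory.DiophantineGeometry.AlgFunctionField

variable {K : Type u} [Field K] {X : Scheme.{u}} [IsIntegral X]

/-! ### The local ring `𝒪_{X,x} ⊆ K(X)` as a (valuation) subring -/

/-- The local ring `𝒪_{X,x}` of the integral scheme `X` as a subring of the function field `K(X)`
(the range of the injective `𝒪_{X,x} → K(X)`, Görtz–Wedhorn I, Prop. 3.29 (1)). [folklore] -/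
def stalkSubring (x : X) : Subring X.functionField := (toFunctionField x).range

/-- Membership in `𝒪_{X,x} ⊆ K(X)` is regularity at `x`. [folklore] -/
theorem mem_stalkSubring_iff {x : X} {h : X.functionField} :
    h ∈ stalkSubring x ↔ IsRegularAt x h := Iff.rfl

/-- `𝒪_{X,x} ≅ 𝒪_{X,x} ⊆ K(X)` (the corestriction of the injective `𝒪_{X,x} → K(X)`). [folklore] -/
def stalkEquiv (x : X) : X.presheaf.stalk x ≃+* stalkSubring x :=
  RingEquiv.ofBijective (toFunctionField x).rangeRestrict
    ⟨fun _ _ h ↦ toFunctionField_injective x (congrArg Subtype.val h),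
      fun ⟨_, a, ha⟩ ↦ ⟨a, Subtype.ext ha⟩⟩

/-- `(stalkEquiv x a : K(X)) = a`. [folklore] -/
@[simp]
theorem coe_stalkEquiv (x : X) (a : X.presheaf.stalk x) :
    ((stalkEquiv x a : stalkSubring x) : X.functionField) = toFunctionField x a := rfl

/-- **When `𝒪_{X,x}` is a valuation ring, it is a valuation subring of `K(X)`** (every rational
function or its inverse is regular at `x`; Mathlib `ValuationRing.isInteger_or_isInteger`). [folklore] -/
def valuationSubringOfPoint (x : X) [ValuationRing (X.presheaf.stalk x)] :
    ValuationSubring X.functionField :=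
  { stalkSubring x with
    mem_or_inv_mem' := fun h ↦ by
      rcases ValuationRing.isInteger_or_isInteger (X.presheaf.stalk x) h with ⟨a, ha⟩ | ⟨a, ha⟩
      · exact Or.inl ⟨a, ha⟩
      · exact Or.inr ⟨a, ha⟩ }

/-- `𝒪_{X,x} ≅` the valuation subring of `x` (corestriction of `𝒪_{X,x} → K(X)`). [folklore] -/
def stalkEquivOfPoint (x : X) [ValuationRing (X.presheaf.stalk x)] :
    X.presheaf.stalk x ≃+* valuationSubringOfPoint x :=
  RingEquiv.ofBijective
    ((toFunctionField x).codRestrict (valuationSubringOfPoint x) fun a ↦ ⟨a, rfl⟩)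
    ⟨fun _ _ h ↦ toFunctionField_injective x (congrArg Subtype.val h),
      fun ⟨_, a, ha⟩ ↦ ⟨a, Subtype.ext ha⟩⟩

/-- `(stalkEquivOfPoint x a : K(X)) = a`. [folklore] -/
@[simp]
theorem coe_stalkEquivOfPoint (x : X) [ValuationRing (X.presheaf.stalk x)]
    (a : X.presheaf.stalk x) :
    ((stalkEquivOfPoint x a : valuationSubringOfPoint x) : X.functionField) = toFunctionField x a :=
  rfl

/-- Membership in the valuation subring of `x` is regularity at `x`. [folklore] -/
theorem mem_valuationSubringOfPoint_iff {x : X} [ValuationRing (X.presheaf.stalk x)]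
    {h : X.functionField} : h ∈ valuationSubringOfPoint x ↔ IsRegularAt x h := Iff.rfl

/-- The underlying subring of the valuation subring of `x` is `𝒪_{X,x} ⊆ K(X)`. [folklore] -/
theorem valuationSubringOfPoint_toSubring (x : X) [ValuationRing (X.presheaf.stalk x)] :
    (valuationSubringOfPoint x).toSubring = stalkSubring x := rfl

/-! ### Non-generic points: the local ring is not a field -/

/-- **At a non-generic point the local ring is not a field**: if `𝒪_{X,x}` is a field then `x` has
no proper generization (`Set.range (X.fromSpecStalk x) = {y | y ⤳ x}`, Mathlib
`Scheme.range_fromSpecStalk`, is a single point), so the generic point of `X` is `x`. [folklore] -/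
theorem maximalIdeal_ne_bot_of_ne_genericPoint {x : X} (hx : x ≠ genericPoint X) :
    maximalIdeal (X.presheaf.stalk x) ≠ ⊥ := by
  intro hbot
  apply hx
  -- the generic point specializes to `x`, hence is in the range of `Spec 𝒪_{X,x} → X`
  have hgen : genericPoint X ∈ Set.range (X.fromSpecStalk x) := by
    rw [Scheme.range_fromSpecStalk]
    exact genericPoint_specializes x
  obtain ⟨p, hp⟩ := hgen
  -- but `Spec 𝒪_{X,x}` has a single point when the maximal ideal is `⊥`
  have hp' : p = closedPoint (X.presheaf.stalk x) := by
    apply PrimeSpectrum.ext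
    have h1 : p.asIdeal ≤ maximalIdeal _ := IsLocalRing.le_maximalIdeal p.isPrime.ne_top
    rw [hbot, le_bot_iff] at h1
    rw [h1]
    change (⊥ : Ideal _) = maximalIdeal _
    exact hbot.symm
  rw [hp', Scheme.fromSpecStalk_closedPoint] at hp
  exact hp

/-- Conversely the local ring at the generic point — the function field — is a field. [folklore] -/
theorem maximalIdeal_eq_bot_genericPoint : maximalIdeal (X.presheaf.stalk (genericPoint X)) = ⊥ :=
  IsLocalRing.isField_iff_maximalIdeal_eq.mp (Field.toIsField X.functionField)


/-! ### The place of a point whose local ring is a discrete valuation ring -/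

section Place

variable [X.Over (Spec (.of K))]

/-- **The place of `K(X)/K` attached to a point `x` with `𝒪_{X,x}` a discrete valuation ring**: the
valuation subring `𝒪_{X,x} ⊆ K(X)` (Hartshorne II.6: the closed points of a nonsingular curve are
the discrete valuation rings of `K(C)/K`; Stichtenoth I.1). [cite: Hartshorne1977, II.6 Lemma 6.5 and Cor. 6.6] -/
def placeOfPoint (x : X) [IsDiscreteValuationRing (X.presheaf.stalk x)] :
    PlaceOver K X.functionField where
  toValuationSubring := valuationSubringOfPoint x
  ne_top h := by
    have hπ := (IsDiscreteValuationRing.exists_irreducible (X.presheaf.stalk x)).choose_spec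
    set π := (IsDiscreteValuationRing.exists_irreducible (X.presheaf.stalk x)).choose
    have hmem : (toFunctionField x π)⁻¹ ∈ valuationSubringOfPoint x := by rw [h]; trivial
    obtain ⟨a, ha⟩ := hmem
    have hπ0 : toFunctionField x π ≠ 0 := (map_ne_zero_iff _ (toFunctionField_injective x)).mpr hπ.ne_zero
    have h1 : toFunctionField x (a * π) = 1 := by rw [map_mul, ha, inv_mul_cancel₀ hπ0]
    have h1' : a * π = 1 := toFunctionField_injective x (by rw [h1, map_one])
    exact hπ.not_isUnit (IsUnit.of_mul_eq_one_right a h1')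
  isDVR := by
    let e := stalkEquivOfPoint x
    haveI : IsNoetherianRing (valuationSubringOfPoint x) := isNoetherianRing_of_ringEquiv _ e
    haveI : IsPrincipalIdealRing (valuationSubringOfPoint x) :=
      IsPrincipalIdealRing.of_surjective (e : X.presheaf.stalk x →+* _) e.surjective
    have hnf : maximalIdeal (valuationSubringOfPoint x) ≠ ⊥ := by
      intro hbot
      apply IsDiscreteValuationRing.not_a_field (X.presheaf.stalk x)
      rw [← le_bot_iff]
      intro a ha
      have hea : e a ∈ maximalIdeal _ := by
        rw [IsLocalRing.mem_maximalIdeal] at ha ⊢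
        exact fun hu ↦ ha (by simpa using hu.map e.symm)
      rw [hbot, Ideal.mem_bot] at hea
      exact (map_eq_zero_iff e e.injective).mp hea
    exact ⟨hnf⟩
  algebraMap_mem c := ⟨algebraMap K (X.presheaf.stalk x) c,
    (IsScalarTower.algebraMap_apply K (X.presheaf.stalk x) X.functionField c).symm⟩

/-- The valuation ring of the place of `x` is `𝒪_{X,x} ⊆ K(X)`. [folklore] -/
@[simp]
theorem placeOfPoint_toValuationSubring (x : X) [IsDiscreteValuationRing (X.presheaf.stalk x)] :
    (placeOfPoint (K := K) x).toValuationSubring = valuationSubringOfPoint x := rfl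

/-- Membership in the valuation ring of the place of `x` is regularity at `x`. [folklore] -/
theorem mem_placeOfPoint_iff {x : X} [IsDiscreteValuationRing (X.presheaf.stalk x)]
    {h : X.functionField} : h ∈ (placeOfPoint (K := K) x).toValuationSubring ↔ IsRegularAt x h :=
  Iff.rfl

end Place

/-! ### Curves over a field: the structure map on `Spec 𝒪_{C,x}` -/

section OverField

variable (C : SchemeOver K) [IsIntegral C.left]

omit [IsIntegral C.left] in
/-- `Spec 𝒪_{C,x} → C → Spec K` is `Spec` of the structure map `K → 𝒪_{C,x}` (`RatFn.algebraStalk`).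
[folklore] -/
theorem fromSpecStalk_comp_hom (x : C.left) :
    C.left.fromSpecStalk x ≫ C.hom =
      Spec.map (CommRingCat.ofHom (algebraMap K (C.left.presheaf.stalk x))) := by
  have h1 : C.hom = C.left.toSpecΓ ≫ Spec.map ((Scheme.ΓSpecIso (.of K)).inv ≫ C.hom.appTop) := by
    rw [Spec.map_comp, ← Scheme.toSpecΓ_naturality_assoc, toSpecΓ_SpecMap_ΓSpecIso_inv,
      Category.comp_id]
  rw [h1, Scheme.fromSpecStalk_toSpecΓ_assoc, ← Spec.map_comp]
  rfl

omit [IsIntegral C.left] in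
/-- Two ring maps `𝒪_{C,x} → R` inducing the same `Spec R → C` through `Spec 𝒪_{C,x} → C` are equal
(`Spec 𝒪_{C,x} → C` is a monomorphism, being a preimmersion). [folklore] -/
theorem ringHom_ext_of_fromSpecStalk {x : C.left} {R : CommRingCat.{u}}
    {g₁ g₂ : C.left.presheaf.stalk x ⟶ R}
    (h : Spec.map g₁ ≫ C.left.fromSpecStalk x = Spec.map g₂ ≫ C.left.fromSpecStalk x) : g₁ = g₂ :=
  Spec.map_injective ((cancel_mono _).mp h)

/-! ### The valuative square of a place -/

/-- **The valuative square of a place `v` of `K(C)/K`**: `Spec K(C) → C` (the generic point) over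
`Spec 𝒪_v → Spec K`. Its lifts `Spec 𝒪_v → C` are the centres of `v` on `C`
(Hartshorne II.4, valuative criteria; II.6 Lemma 6.5). [cite: Hartshorne1977, II.4 Thm. 4.3 and II.6 Lemma 6.5] -/
abbrev placeSq (v : PlaceOver K C.left.functionField) : ValuativeCommSq C.hom where
  R := v.toValuationSubring
  K := C.left.functionField
  i₁ := C.left.fromSpecStalk (genericPoint C.left)
  i₂ := Spec.map (CommRingCat.ofHom (algebraMap K v.toValuationSubring))
  commSq := ⟨by
    rw [fromSpecStalk_comp_hom, ← Spec.map_comp, ← CommRingCat.ofHom_comp,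
      ← IsScalarTower.algebraMap_eq K v.toValuationSubring C.left.functionField]⟩

variable {C}

/-- The ring map `𝒪_{C,x} → 𝒪_v` when every function regular at `x` lies in `𝒪_v`. [folklore] -/
def stalkToPlace (v : PlaceOver K C.left.functionField) (x : C.left)
    (hx : ∀ f, IsRegularAt x f → f ∈ v.toValuationSubring) :
    C.left.presheaf.stalk x →+* v.toValuationSubring :=
  (toFunctionField x).codRestrict v.toValuationSubring fun a ↦ hx _ ⟨a, rfl⟩

/-- `(stalkToPlace v x hx a : K(C)) = a`. [folklore] -/
@[simp]
theorem coe_stalkToPlace (v : PlaceOver K C.left.functionField) (x : C.left)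
    (hx : ∀ f, IsRegularAt x f → f ∈ v.toValuationSubring) (a : C.left.presheaf.stalk x) :
    ((stalkToPlace v x hx a : v.toValuationSubring) : C.left.functionField) = toFunctionField x a :=
  rfl

/-- **The lift `Spec 𝒪_v → C` through a point `x` dominated by `v`**: `Spec 𝒪_v → Spec 𝒪_{C,x} → C`.
[cite: Hartshorne1977, II.4 (proof of Thm. 4.3)] -/
def liftOfPoint (v : PlaceOver K C.left.functionField) (x : C.left)
    (hx : ∀ f, IsRegularAt x f → f ∈ v.toValuationSubring) :
    Spec (.of v.toValuationSubring) ⟶ C.left :=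
  Spec.map (CommRingCat.ofHom (stalkToPlace v x hx)) ≫ C.left.fromSpecStalk x

/-- The lift through `x` restricts to the generic point on `Spec K(C)`. [folklore] -/
theorem SpecMap_comp_liftOfPoint (v : PlaceOver K C.left.functionField) (x : C.left)
    (hx : ∀ f, IsRegularAt x f → f ∈ v.toValuationSubring) :
    Spec.map (CommRingCat.ofHom (algebraMap v.toValuationSubring C.left.functionField)) ≫
        liftOfPoint v x hx = C.left.fromSpecStalk (genericPoint C.left) := by
  rw [liftOfPoint, ← Spec.map_comp_assoc, ← CommRingCat.ofHom_comp]
  exact Scheme.SpecMap_stalkSpecializes_fromSpecStalk (genericPoint_specializes x)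

/-- The lift through `x` lies over `Spec 𝒪_v → Spec K`. [folklore] -/
theorem liftOfPoint_comp_hom (v : PlaceOver K C.left.functionField) (x : C.left)
    (hx : ∀ f, IsRegularAt x f → f ∈ v.toValuationSubring) :
    liftOfPoint v x hx ≫ C.hom = Spec.map (CommRingCat.ofHom (algebraMap K v.toValuationSubring)) := by
  rw [liftOfPoint, Category.assoc, fromSpecStalk_comp_hom, ← Spec.map_comp, ← CommRingCat.ofHom_comp]
  congr 2
  ext c
  change toFunctionField x (algebraMap K (C.left.presheaf.stalk x) c) =
    ((algebraMap K v.toValuationSubring c : v.toValuationSubring) : C.left.functionField)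
  rw [PlaceOver.algebraMap_toValuationSubring_apply]
  exact (IsScalarTower.algebraMap_apply K (C.left.presheaf.stalk x) C.left.functionField c).symm

/-- The lift through `x` as a lift structure of the valuative square of `v`. [folklore] -/
def liftStructOfPoint (v : PlaceOver K C.left.functionField) (x : C.left)
    (hx : ∀ f, IsRegularAt x f → f ∈ v.toValuationSubring) : (placeSq C v).commSq.LiftStruct where
  l := liftOfPoint v x hx
  fac_left := SpecMap_comp_liftOfPoint v x hx
  fac_right := liftOfPoint_comp_hom v x hx

/-- When `𝒪_v` is *exactly* the ring of functions regular at `x`, `𝒪_{C,x} → 𝒪_v` is a local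
homomorphism (indeed an isomorphism). [folklore] -/
theorem isLocalHom_stalkToPlace (v : PlaceOver K C.left.functionField) (x : C.left)
    (hx : ∀ f, IsRegularAt x f → f ∈ v.toValuationSubring)
    (hx' : ∀ f, f ∈ v.toValuationSubring → IsRegularAt x f) : IsLocalHom (stalkToPlace v x hx) := by
  refine ⟨fun a ha ↦ ?_⟩
  obtain ⟨u, hu⟩ := ha
  have ha0 : toFunctionField x a ≠ 0 := by
    intro h0
    have : ((u : v.toValuationSubring) : C.left.functionField) = 0 := by rw [hu]; exact h0
    exact u.ne_zero (Subtype.ext this)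
  -- the inverse of `a` in `K(C)` lies in `𝒪_v`, hence is regular at `x`
  have hinv : (toFunctionField x a)⁻¹ ∈ v.toValuationSubring := by
    have h1 : ((u⁻¹ : (v.toValuationSubring)ˣ) : v.toValuationSubring) * (u : v.toValuationSubring) = 1 :=
      Units.inv_mul u
    have h2 : (((u⁻¹ : (v.toValuationSubring)ˣ) : v.toValuationSubring) : C.left.functionField) *
        toFunctionField x a = 1 := by
      have := congrArg (fun z : v.toValuationSubring ↦ (z : C.left.functionField)) h1
      simpa only [MulMemClass.coe_mul, OneMemClass.coe_one, hu, coe_stalkToPlace] using this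
    rw [← eq_inv_of_mul_eq_one_left h2]
    exact Subtype.mem _
  obtain ⟨b, hb⟩ := hx' _ hinv
  have hab : a * b = 1 := toFunctionField_injective x (by rw [map_mul, hb, mul_inv_cancel₀ ha0, map_one])
  exact IsUnit.of_mul_eq_one b hab

/-- The lift through such an `x` sends the closed point of `Spec 𝒪_v` to `x`. [folklore] -/
theorem liftOfPoint_closedPoint (v : PlaceOver K C.left.functionField) (x : C.left)
    (hx : ∀ f, IsRegularAt x f → f ∈ v.toValuationSubring)
    (hx' : ∀ f, f ∈ v.toValuationSubring → IsRegularAt x f) :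
    liftOfPoint v x hx (closedPoint v.toValuationSubring) = x := by
  haveI := isLocalHom_stalkToPlace v x hx hx'
  rw [liftOfPoint, Scheme.Hom.comp_apply, Spec.map_apply]
  change C.left.fromSpecStalk x (PrimeSpectrum.comap (stalkToPlace v x hx) (closedPoint _)) = x
  rw [comap_closedPoint, Scheme.fromSpecStalk_closedPoint]

end OverField

/-! ### Smooth curves: every non-generic point gives a place -/

section SmoothCurve

variable (C : SchemeOver K) [IsIntegral C.left] [SmoothOfRelativeDimension 1 C.hom]

/-- **The local ring of a smooth curve at a non-generic point is a discrete valuation ring**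
(Hartshorne II.6.2A / III.9.7: regular local of dimension one; the tree's
`valuationRing_stalk_of_smoothCurve`, noetherianity, and `maximalIdeal_ne_bot_of_ne_genericPoint`).
[cite: Hartshorne1977, I Thm. 6.2A and II.6] -/
theorem isDiscreteValuationRing_stalk {x : C.left} (hx : x ≠ genericPoint C.left) :
    IsDiscreteValuationRing (C.left.presheaf.stalk x) := by
  haveI : ValuationRing (C.left.presheaf.stalk x) := valuationRing_stalk_of_smoothCurve C x
  haveI : Smooth C.hom := SmoothOfRelativeDimension.smooth 1 C.hom
  haveI : IsLocallyNoetherian C.left := LocallyOfFiniteType.isLocallyNoetherian C.hom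
  haveI : IsPrincipalIdealRing (C.left.presheaf.stalk x) :=
    ((tfae_of_isNoetherianRing_of_isLocalRing_of_isDomain (C.left.presheaf.stalk x)).out 0 1).mpr
      ‹ValuationRing _›
  exact ⟨maximalIdeal_ne_bot_of_ne_genericPoint hx⟩

/-- **The place of `K(C)/K` at a non-generic (= closed) point `x` of the smooth curve `C`**
(Hartshorne II.6: `t ↦ 𝒪_{C,P}` identifies the closed points of a nonsingular curve with discrete
valuation rings of `K(C)/K`). [cite: Hartshorne1977, II.6 Lemma 6.5 and Cor. 6.6] -/
def place (x : C.left) (hx : x ≠ genericPoint C.left) : PlaceOver K C.left.functionField :=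
  haveI := isDiscreteValuationRing_stalk C hx
  placeOfPoint x

variable {C}

/-- Membership in `𝒪_{place x}` is regularity at `x`. [folklore] -/
theorem mem_place_iff {x : C.left} (hx : x ≠ genericPoint C.left) {f : C.left.functionField} :
    f ∈ (place C x hx).toValuationSubring ↔ IsRegularAt x f := Iff.rfl

/-- **`x ↦ place x` is injective** for `C` separated over `K`: two centres of the same valuation
coincide (valuative criterion of separatedness, Mathlib `IsSeparated.valuativeCriterion`).
[cite: Hartshorne1977, II.4 Thm. 4.3 and II.6 Lemma 6.5] -/
theorem place_injective [IsSeparated C.hom] {x y : C.left} (hx : x ≠ genericPoint C.left)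
    (hy : y ≠ genericPoint C.left) (h : place C x hx = place C y hy) : x = y := by
  have hxv : ∀ f, IsRegularAt x f → f ∈ (place C x hx).toValuationSubring :=
    fun f hf ↦ (mem_place_iff hx).mpr hf
  have hxv' : ∀ f, f ∈ (place C x hx).toValuationSubring → IsRegularAt x f :=
    fun f hf ↦ (mem_place_iff hx).mp hf
  have hyv : ∀ f, IsRegularAt y f → f ∈ (place C x hx).toValuationSubring := fun f hf ↦ by
    rw [h]; exact (mem_place_iff hy).mpr hf
  have hyv' : ∀ f, f ∈ (place C x hx).toValuationSubring → IsRegularAt y f := fun f hf ↦ by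
    rw [h] at hf; exact (mem_place_iff hy).mp hf
  have hsub : Subsingleton (placeSq C (place C x hx)).commSq.LiftStruct :=
    IsSeparated.valuativeCriterion C.hom _
  have heq := congrArg CommSq.LiftStruct.l
    (hsub.elim (liftStructOfPoint _ x hxv) (liftStructOfPoint _ y hyv))
  change liftOfPoint _ x hxv = liftOfPoint _ y hyv at heq
  rw [← liftOfPoint_closedPoint _ x hxv hxv', ← liftOfPoint_closedPoint _ y hyv hyv', heq]

/-- **Every place of `K(C)/K` is the place of a point** of the complete curve `C`
(valuative criterion of properness: the centre of `v` exists, Hartshorne II.4.7 / II.6.7; then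
`𝒪_{C,x} ⊆ 𝒪_v` are discrete valuation rings of `K(C)`, hence equal). [cite: Hartshorne1977, II.6 Lemma 6.5 and Cor. 6.6] -/
theorem exists_place_eq [IsProper C.hom] (v : PlaceOver K C.left.functionField) :
    ∃ (x : C.left) (hx : x ≠ genericPoint C.left), place C x hx = v := by
  -- existence part of the valuative criterion for the universally closed `C → Spec K`
  have hE : ValuativeCriterion.Existence C.hom := by
    have h : (ValuativeCriterion.Existence ⊓ @QuasiCompact) C.hom := by
      rw [← UniversallyClosed.eq_valuativeCriterion]; infer_instance
    exact h.1
  obtain ⟨l, hl₁, hl₂⟩ := (hE (placeSq C v)).exists_lift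
  -- the centre `x` and the local homomorphism `𝒪_{C,x} → 𝒪_v`
  let x : C.left := l (closedPoint _)
  let φ := Scheme.stalkClosedPointTo l
  have hφl : Spec.map φ ≫ C.left.fromSpecStalk x = l := Scheme.Spec_stalkClosedPointTo_fromSpecStalk l
  -- `𝒪_{C,x} → 𝒪_v → K(C)` is the inclusion `𝒪_{C,x} ⊆ K(C)`
  have hcomp : φ ≫ CommRingCat.ofHom (algebraMap v.toValuationSubring C.left.functionField) =
      CommRingCat.ofHom (toFunctionField x) := by
    apply ringHom_ext_of_fromSpecStalk C
    rw [Spec.map_comp, Category.assoc, hφl]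
    change Spec.map _ ≫ l = Spec.map (C.left.presheaf.stalkSpecializes (genericPoint_specializes x)) ≫ _
    rw [Scheme.SpecMap_stalkSpecializes_fromSpecStalk]
    exact hl₁
  have hφ : ∀ a, (φ a).1 = toFunctionField x a :=
    fun a ↦ congrArg (fun g : C.left.presheaf.stalk x ⟶ CommRingCat.of C.left.functionField ↦ g a) hcomp
  -- hence every function regular at `x` lies in `𝒪_v`
  have hsub : ∀ f, IsRegularAt x f → f ∈ v.toValuationSubring := by
    rintro f ⟨a, rfl⟩
    rw [← hφ a]; exact Subtype.mem _
  -- `x` is not the generic point: otherwise `𝒪_v = K(C)`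
  have hx : x ≠ genericPoint C.left := by
    intro hxe
    apply v.ne_top
    refine top_unique fun f _ ↦ hsub f ?_
    rw [hxe]
    exact isRegularAt_genericPoint f
  refine ⟨x, hx, PlaceOver.ext ?_⟩
  haveI := isDiscreteValuationRing_stalk C hx
  exact ValuationSubring.eq_of_le_of_ne_top (place C x hx).toValuationSubring
    (fun f hf ↦ hsub f hf) v.ne_top

/-- **Closed points of the complete nonsingular curve `C` ↔ places of `K(C)/K`** (Hartshorne II.6,
Cor. 6.6 / Lemma 6.5: "`P ↦ 𝒪_P` … a bijection between the points of `C` and the discrete valuation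
rings of `K/k`"; Stichtenoth I.1 for the function-field side). Here the closed points are the
non-generic points of the integral one-dimensional `C`. [cite: Hartshorne1977, II.6 Lemma 6.5 and Cor. 6.6] -/
def pointEquivPlace [IsProper C.hom] :
    {x : C.left // x ≠ genericPoint C.left} ≃ PlaceOver K C.left.functionField :=
  Equiv.ofBijective (fun x ↦ place C x.1 x.2)
    ⟨fun x y h ↦ Subtype.ext (place_injective x.2 y.2 h),
      fun v ↦ by obtain ⟨x, hx, h⟩ := exists_place_eq (C := C) v; exact ⟨⟨x, hx⟩, h⟩⟩

/-- Unfolding `pointEquivPlace`. [folklore] -/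
@[simp]
theorem pointEquivPlace_apply [IsProper C.hom] (x : {x : C.left // x ≠ genericPoint C.left}) :
    pointEquivPlace (C := C) x = place C x.1 x.2 := rfl

/-- The point of a place: the centre of the valuation on the complete curve. [cite: Hartshorne1977, II.6 Cor. 6.6] -/
def pointOfPlace [IsProper C.hom] (v : PlaceOver K C.left.functionField) : C.left :=
  ((pointEquivPlace (C := C)).symm v).1

/-- The point of a place is not the generic point. [folklore] -/
theorem pointOfPlace_ne_genericPoint [IsProper C.hom] (v : PlaceOver K C.left.functionField) :
    pointOfPlace (C := C) v ≠ genericPoint C.left :=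
  ((pointEquivPlace (C := C)).symm v).2

/-- `place (pointOfPlace v) = v`. [folklore] -/
@[simp]
theorem place_pointOfPlace [IsProper C.hom] (v : PlaceOver K C.left.functionField) :
    place C (pointOfPlace (C := C) v) (pointOfPlace_ne_genericPoint v) = v :=
  (pointEquivPlace (C := C)).apply_symm_apply v

/-- `pointOfPlace (place x) = x`. [folklore] -/
@[simp]
theorem pointOfPlace_place [IsProper C.hom] {x : C.left} (hx : x ≠ genericPoint C.left) :
    pointOfPlace (C := C) (place C x hx) = x :=
  congrArg Subtype.val ((pointEquivPlace (C := C)).symm_apply_apply ⟨x, hx⟩)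

/-- A function lies in `𝒪_v` iff it is regular at the point of `v`. [cite: Hartshorne1977, II.6 Cor. 6.6] -/
theorem mem_iff_isRegularAt_pointOfPlace [IsProper C.hom] (v : PlaceOver K C.left.functionField)
    (f : C.left.functionField) : f ∈ v.toValuationSubring ↔ IsRegularAt (pointOfPlace (C := C) v) f := by
  conv_lhs => rw [← place_pointOfPlace (C := C) v]
  exact mem_place_iff _

end SmoothCurve

end CurvePlaces

end Literature.AlgebraicGeometry.Motives
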